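import Literature.Analysis.FluidPDE.SolenoidalCZeroSpace
import HarnessLib

/-!
# Pointwise-defined operators on `C₀,σ`: a compact linear part and a strictly differentiable map

Analysis/FluidPDE support file (everything proved; no definitions, no named facts).  On the
closed submodule `F ≅ C₀,σ` of `ℓ^∞(E; E)` (`SolenoidalCZeroSpace.lean`: continuous, vanishing
at infinity, weakly divergence-free fields with the sup norm) we realise two kinds of operators
which analytic constructions deliver **pointwise on functions** — the typical output of a
fixed-point construction for a perturbation equation around a background flow over one period
(Koch–Nadirashvili–Seregin–Šverák 2009, §4: the integral equation as an ODE in a space of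
bounded fields; Henry 1981, §3.4: differentiable dependence of the solution map):

* `exists_compact_clm_of_pointwise` — a map `Klin` on fields, linear on the class, mapping it to
  itself with a sup bound, whose image of the unit ball is uniformly small at infinity and
  uniformly equicontinuous, is a **compact** bounded operator `K : F →L[ℝ] F` with
  `(K f)(x) = Klin f (x)` (Arzelà–Ascoli modulo tails, `isCompactOperator_of_tails_of_equicontinuous`);
* `exists_selfMap_hasStrictFDerivAt_zero` — a map `Φ₁` on fields defined on the `δ₀`-ball of
  the class (values in the class, `Φ₁ 0 = 0`) with the remainder estimate
  `‖Φ₁g₁ − Φ₁g₂ − (e^{τΔ} + Klin)(g₁ − g₂)‖_∞ ≤ ε‖g₁ − g₂‖_∞` near `0` is a self-map `P` of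
  `F` (junk `0` off the ball) with `P 0 = 0` and STRICT derivative `H + K` at `0`, `H`, `K` the
  bounded operators realising `e^{τΔ}` and `Klin`.

## Mathlib / tree search

Tree: `exists_clm_of_pointwise`, `isCompactOperator_of_tails_of_equicontinuous`,
`hasStrictFDerivAt_zero_of_pointwise`, `norm_apply_le_norm_submodule`,
`norm_le_of_forall_le_submodule` (`SupNormSubmoduleOperators`), `heatFlow_of_pos`.
Mathlib: `lp`, `memℓp_infty`, `IsCompactOperator`, `HasStrictFDerivAt`.

## References

* G. Koch, N. Nadirashvili, G. Seregin, V. Šverák, Acta Math. 203 (2009), §4 (4.3)–(4.4).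
  [KochNadirashviliSereginSverak2009]
* D. Henry, *Geometric Theory of Semilinear Parabolic Equations*, LNM 840, Springer 1981,
  Thm. 3.4.4. [Henry1981]
-/

noncomputable section

open MeasureTheory Set Function Filter Metric
open _root_.Topology

namespace Literature.Analysis.FluidPDE

variable {E : Type*} [NormedAddCommGroup E] [InnerProductSpace ℝ E] [FiniteDimensional ℝ E]
  [MeasurableSpace E] [BorelSpace E]

/-- **A pointwise linear operator with uniformly decaying, equicontinuous image of the unit
ball is a compact operator of `C₀,σ`.**  Let `Klin` act on fields, additively and homogeneously
on the class (continuous, vanishing at infinity, weakly divergence free), mapping bounded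
members of the class into the class with `‖Klin h‖_∞ ≤ Λ‖h‖_∞`, and such that the images of
the members of sup norm `≤ 1` are uniformly small outside large balls and uniformly
equicontinuous.  Then `Klin` is realised by a compact bounded operator `K` of the closed
submodule `F ≅ C₀,σ`, `(K f)(x) = Klin f (x)`, `‖K‖ ≤ Λ` (Arzelà–Ascoli modulo tails). [folklore] -/
theorem exists_compact_clm_of_pointwise (F : Submodule ℝ (lp (fun _ : E => E) ⊤))
    (hFc : IsClosed (F : Set (lp (fun _ : E => E) ⊤)))
    (hF : ∀ f : lp (fun _ : E => E) ⊤, f ∈ F ↔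
      (Continuous ⇑f ∧ Tendsto ⇑f (cocompact E) (𝓝 0) ∧ IsWeaklyDivFree ⇑f))
    (Klin : (E → E) → E → E) {Λ : ℝ} (hΛ : 0 ≤ Λ)
    (hlin : ∀ h₁ h₂ : E → E, Continuous h₁ → Tendsto h₁ (cocompact E) (𝓝 0) → IsWeaklyDivFree h₁ →
      Continuous h₂ → Tendsto h₂ (cocompact E) (𝓝 0) → IsWeaklyDivFree h₂ → ∀ r : ℝ,
        Klin (h₁ + h₂) = Klin h₁ + Klin h₂ ∧ Klin (r • h₁) = r • Klin h₁)
    (hmap : ∀ h : E → E, Continuous h → Tendsto h (cocompact E) (𝓝 0) → IsWeaklyDivFree h →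
      ∀ B : ℝ, (∀ x, ‖h x‖ ≤ B) →
        Continuous (Klin h) ∧ Tendsto (Klin h) (cocompact E) (𝓝 0) ∧ IsWeaklyDivFree (Klin h) ∧
          ∀ x, ‖Klin h x‖ ≤ Λ * B)
    (htail : ∀ ε : ℝ, 0 < ε → ∃ A : ℝ, ∀ h : E → E, Continuous h → Tendsto h (cocompact E) (𝓝 0) →
      IsWeaklyDivFree h → (∀ x, ‖h x‖ ≤ 1) → ∀ x, A ≤ ‖x‖ → ‖Klin h x‖ ≤ ε)
    (hequi : ∀ ε : ℝ, 0 < ε → ∃ δ : ℝ, 0 < δ ∧ ∀ h : E → E, Continuous h →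
      Tendsto h (cocompact E) (𝓝 0) → IsWeaklyDivFree h → (∀ x, ‖h x‖ ≤ 1) →
        ∀ x y, dist x y < δ → ‖Klin h x - Klin h y‖ ≤ ε) :
    ∃ K : F →L[ℝ] F, (∀ (f : F) (x : E), (K f).1 x = Klin (⇑f.1) x) ∧ ‖K‖ ≤ Λ ∧
      IsCompactOperator K := by
  obtain ⟨K, hK, hKn⟩ := FunctionSpaces.exists_clm_of_pointwise F
    (P := fun g => Continuous g ∧ Tendsto g (cocompact E) (𝓝 0) ∧ IsWeaklyDivFree g) hF Klin hΛ
    (fun g h hg hh => (hlin g h hg.1 hg.2.1 hg.2.2 hh.1 hh.2.1 hh.2.2 1).1)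
    (fun r g hg => (hlin g g hg.1 hg.2.1 hg.2.2 hg.1 hg.2.1 hg.2.2 r).2)
    (fun g hg B hB => by
      obtain ⟨h1, h2, h3, h4⟩ := hmap g hg.1 hg.2.1 hg.2.2 B hB
      exact ⟨⟨h1, h2, h3⟩, h4⟩)
  have hPf : ∀ f : F, Continuous ⇑f.1 ∧ Tendsto ⇑f.1 (cocompact E) (𝓝 0) ∧ IsWeaklyDivFree ⇑f.1 :=
    fun f => (hF f.1).1 f.2
  have hball : ∀ f : F, ‖f‖ ≤ 1 → ∀ x, ‖f.1 x‖ ≤ 1 := fun f hf x =>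
    (FunctionSpaces.norm_apply_le_norm_submodule F f x).trans hf
  refine ⟨K, hK, hKn, FunctionSpaces.isCompactOperator_of_tails_of_equicontinuous F hFc K 0 ?_ ?_⟩
  · intro ε hε
    obtain ⟨A, hA⟩ := htail ε hε
    refine ⟨A, fun f hf x hx => ?_⟩
    rw [hK]
    rw [dist_zero_right] at hx
    exact hA _ (hPf f).1 (hPf f).2.1 (hPf f).2.2 (hball f hf) x hx
  · intro ε hε
    obtain ⟨δ, hδ, hδK⟩ := hequi ε hε
    refine ⟨δ, hδ, fun f hf x y hxy => ?_⟩
    rw [hK, hK]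
    exact hδK _ (hPf f).1 (hPf f).2.1 (hPf f).2.2 (hball f hf) x y hxy

/-- **A pointwise-defined self-map of the `δ₀`-ball of `C₀,σ` with a sup-norm remainder
estimate is strictly differentiable at `0`.**  Let `Φ₁` map members `g` of the class of sup norm
`< δ₀` to members of the class bounded by `Λ‖g‖_∞`, with `Φ₁ 0 = 0`, and suppose that for
every `ε > 0` there is `δ > 0` with
`‖(Φ₁g₁ − Φ₁g₂)(x) − (e^{τΔ}(g₁ − g₂)(x) + Klin(g₁ − g₂)(x))‖ ≤ ε · Bd` for all `x` whenever
`‖g₁‖, ‖g₂‖ ≤ B < δ` and `‖g₁ − g₂‖ ≤ Bd` pointwise.  If `H`, `K` are bounded operators of the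
closed submodule `F ≅ C₀,σ` realising `e^{τΔ}` and `Klin`, then `P g = Φ₁ g` (`‖g‖ < δ₀`),
`P g = 0` (otherwise) is a self-map of `F` with `P 0 = 0` and `HasStrictFDerivAt P (H + K) 0`
(Henry 1981, §3.4). [cite: Henry1981, Thm. 3.4.4] -/
theorem exists_selfMap_hasStrictFDerivAt_zero (F : Submodule ℝ (lp (fun _ : E => E) ⊤))
    (hF : ∀ f : lp (fun _ : E => E) ⊤, f ∈ F ↔
      (Continuous ⇑f ∧ Tendsto ⇑f (cocompact E) (𝓝 0) ∧ IsWeaklyDivFree ⇑f))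
    (Φ₁ : (E → E) → E → E) (Klin : (E → E) → E → E) {δ₀ Λ τ : ℝ} (hδ₀ : 0 < δ₀) (hτ : 0 < τ)
    (hΦ0 : ∀ x, Φ₁ 0 x = 0)
    (hsol : ∀ g : E → E, Continuous g → Tendsto g (cocompact E) (𝓝 0) → IsWeaklyDivFree g →
      ∀ B : ℝ, (∀ x, ‖g x‖ ≤ B) → B < δ₀ →
        Continuous (Φ₁ g) ∧ Tendsto (Φ₁ g) (cocompact E) (𝓝 0) ∧ IsWeaklyDivFree (Φ₁ g) ∧
          ∀ x, ‖Φ₁ g x‖ ≤ Λ * B)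
    (hder : ∀ ε : ℝ, 0 < ε → ∃ δ : ℝ, 0 < δ ∧ ∀ g₁ g₂ : E → E,
      Continuous g₁ → Tendsto g₁ (cocompact E) (𝓝 0) → IsWeaklyDivFree g₁ →
      Continuous g₂ → Tendsto g₂ (cocompact E) (𝓝 0) → IsWeaklyDivFree g₂ →
      ∀ B Bd : ℝ, (∀ x, ‖g₁ x‖ ≤ B) → (∀ x, ‖g₂ x‖ ≤ B) → B < δ → (∀ x, ‖g₁ x - g₂ x‖ ≤ Bd) →
        ∀ x, ‖(Φ₁ g₁ x - Φ₁ g₂ x) - (heatFlow (g₁ - g₂) τ x + Klin (g₁ - g₂) x)‖ ≤ ε * Bd)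
    (H K : F →L[ℝ] F)
    (hH : ∀ (f : F) (x : E), (H f).1 x = UnboundedOperators.heatExtension (⇑f.1) τ x)
    (hK : ∀ (f : F) (x : E), (K f).1 x = Klin (⇑f.1) x) :
    ∃ P : F → F, (∀ f : F, ‖f‖ < δ₀ → ∀ x, (P f).1 x = Φ₁ (⇑f.1) x) ∧
      (∀ f : F, δ₀ ≤ ‖f‖ → P f = 0) ∧ P 0 = 0 ∧ HasStrictFDerivAt P (H + K) 0 := by
  classical
  have hPf : ∀ f : F, Continuous ⇑f.1 ∧ Tendsto ⇑f.1 (cocompact E) (𝓝 0) ∧ IsWeaklyDivFree ⇑f.1 :=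
    fun f => (hF f.1).1 f.2
  have hbd : ∀ f : F, ∀ x, ‖f.1 x‖ ≤ ‖f‖ := fun f => FunctionSpaces.norm_apply_le_norm_submodule F f
  have hsol' : ∀ f : F, ‖f‖ < δ₀ →
      (Continuous (Φ₁ ⇑f.1) ∧ Tendsto (Φ₁ ⇑f.1) (cocompact E) (𝓝 0) ∧ IsWeaklyDivFree (Φ₁ ⇑f.1)) ∧
        ∀ x, ‖Φ₁ (⇑f.1) x‖ ≤ Λ * ‖f‖ := fun f hf => by
    obtain ⟨h1, h2, h3, h4⟩ := hsol _ (hPf f).1 (hPf f).2.1 (hPf f).2.2 ‖f‖ (hbd f) hf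
    exact ⟨⟨h1, h2, h3⟩, h4⟩
  have hmem : ∀ f : F, ‖f‖ < δ₀ → Memℓp (Φ₁ ⇑f.1) ⊤ := fun f hf =>
    memℓp_infty ⟨Λ * ‖f‖, by rintro _ ⟨x, rfl⟩; exact (hsol' f hf).2 x⟩
  have hF' : ∀ (f : F) (hf : ‖f‖ < δ₀), (⟨Φ₁ ⇑f.1, hmem f hf⟩ : lp (fun _ : E => E) ⊤) ∈ F :=
    fun f hf => (hF _).2 (hsol' f hf).1
  let P : F → F := fun f => if hf : ‖f‖ < δ₀ then ⟨⟨Φ₁ ⇑f.1, hmem f hf⟩, hF' f hf⟩ else 0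
  have hPin : ∀ f : F, ‖f‖ < δ₀ → ∀ x, (P f).1 x = Φ₁ (⇑f.1) x := fun f hf x => by
    simp only [P, dif_pos hf]
  have hPout : ∀ f : F, δ₀ ≤ ‖f‖ → P f = 0 := fun f hf => by
    simp only [P, dif_neg (not_lt.2 hf)]
  have hP0 : P 0 = 0 := by
    refine Subtype.ext (lp.ext (funext fun x => ?_))
    rw [hPin 0 (by simpa using hδ₀) x]
    have h0 : (⇑(0 : F).1 : E → E) = 0 := by simp; rfl
    rw [h0]
    change Φ₁ 0 x = (0 : F).1 x
    rw [hΦ0 x]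
    simp
  refine ⟨P, hPin, hPout, hP0, ?_⟩
  refine FunctionSpaces.hasStrictFDerivAt_zero_of_pointwise F fun ε hε => ?_
  obtain ⟨δ, hδ, hδP⟩ := hder ε hε
  refine ⟨min δ δ₀, lt_min hδ hδ₀, fun g₁ g₂ hg₁ hg₂ x => ?_⟩
  have hg₁' : ‖g₁‖ < δ₀ := lt_of_lt_of_le hg₁ (min_le_right _ _)
  have hg₂' : ‖g₂‖ < δ₀ := lt_of_lt_of_le hg₂ (min_le_right _ _)
  set B : ℝ := max ‖g₁‖ ‖g₂‖ with hB
  have hBδ : B < δ := max_lt (lt_of_lt_of_le hg₁ (min_le_left _ _)) (lt_of_lt_of_le hg₂ (min_le_left _ _))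
  have hsub : ∀ y, ‖g₁.1 y - g₂.1 y‖ ≤ ‖g₁ - g₂‖ := fun y => by
    have h := hbd (g₁ - g₂) y
    simpa using h
  have key := hδP _ _ (hPf g₁).1 (hPf g₁).2.1 (hPf g₁).2.2 (hPf g₂).1 (hPf g₂).2.1 (hPf g₂).2.2
    B ‖g₁ - g₂‖ (fun y => (hbd g₁ y).trans (le_max_left _ _))
    (fun y => (hbd g₂ y).trans (le_max_right _ _)) hBδ hsub x
  have hcoe : (⇑(g₁ - g₂).1 : E → E) = ⇑g₁.1 - ⇑g₂.1 := by simp; rfl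
  have hL : ((H + K) (g₁ - g₂)).1 x = heatFlow (⇑g₁.1 - ⇑g₂.1) τ x + Klin (⇑g₁.1 - ⇑g₂.1) x := by
    have h1 := hH (g₁ - g₂) x
    have h2 := hK (g₁ - g₂) x
    rw [hcoe] at h1 h2
    rw [heatFlow_of_pos _ hτ, ← h1, ← h2]
    simp
  rw [hPin g₁ hg₁', hPin g₂ hg₂', hL]
  exact key

end Literature.Analysis.FluidPDE

end
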